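import Mathlib

/-!
# Certified per-path labels — definitions: AND/OR trees with child selectors, pass-over paths and heights

Route `PneNP/SymmetryBudget`, item `NoHiddenOrder` (stmt-PneNP-14781).  Memo ANALYSIS-4 (evidence on the
item) reduces `NoHiddenOrder` to the TREE-SIZE bound of the Corneil–Goldberg canonisation process
(D. G. Corneil, M. K. Goldberg, J. Algorithms 5 (1984) 345–362) through a symmetric circuit whose gate
groups are indexed by labels `(U, X, λ)`; its completeness rests on two finite-combinatorial facts about
the objects defined here (theorems in `SymmetryBudgetNoHiddenOrderCertifiedLabels.lean`):

* `AOTree` — a finite AND/OR tree (`orNode n c`: an individualisation node with `n` children, one per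
  vertex of the individualised cell; `andNode n c`: a section node with `n` parts); `leaves`; a child
  `Selector` fixes a SOLUTION SUBTREE (its child at OR nodes, all children at AND nodes); `pathCost sel T`
  is the maximum over the root–leaf paths of that solution subtree of the product of the OR-degrees met;
  `IsMinLeaf sel`: the selector keeps a child with the fewest leaves (ANALYSIS-4, Prop. B).
* `PassOverPath V t` — the individualisation steps of ONE root–leaf path of the recursion tree: step `i`
  takes `x i` out of the cell `A i`; earlier individualised vertices are absent from later cells (`gone`)
  and a later cell meeting an earlier cell lies inside it (`nest`: cells only refine or restrict along a
  path).  `PassOver i j`: `i < j` and `x j ∈ A i` (step `i` passes over the vertex of step `j`).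
  `height i`: the length of the longest pass-over chain from `i` — the certified value `v` of
  ANALYSIS-4, Lemma C.

Mathlib only; objects posited by the route's positive line (reviewed Defs file); supports stmt-PneNP-14781.
-/

-- `Summit.PneNP.PneNP.…` duplicates `PneNP` BY DESIGN (single-problem summit, D-0017 layout).
set_option linter.dupNamespace false

namespace Summit.PneNP.PneNP.Theorems

namespace CertifiedLabels

open Finset

/-! ### AND/OR trees, selectors, path costs -/

/-- A finite AND/OR tree: `orNode n c` has the `n` children `c i` (one per vertex of the individualised
cell), `andNode n c` has the `n` parts `c i` of a section. -/
inductive AOTree : Type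
  | leaf : AOTree
  | orNode (n : ℕ) (c : Fin n → AOTree) : AOTree
  | andNode (n : ℕ) (c : Fin n → AOTree) : AOTree

namespace AOTree

/-- Number of leaves. -/
def leaves : AOTree → ℕ
  | leaf => 1
  | orNode n c => ∑ i : Fin n, leaves (c i)
  | andNode n c => ∑ i : Fin n, leaves (c i)

/-- A CHILD SELECTOR: at an OR node with children `c : Fin n → AOTree`, `n ≠ 0`, the index of the child
kept in the solution subtree. -/
def Selector : Type := ∀ (n : ℕ), (Fin n → AOTree) → n ≠ 0 → Fin n

/-- `pathCost sel T`: the maximum over the root–leaf paths of the `sel`-solution subtree of `T` (the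
`sel`-child at OR nodes, all children at AND nodes) of the product of the OR-degrees on the path.
(A childless OR node contributes `0`; `Finset.sup` over no parts is `0`, both junk-free for the bound
`pathCost ≤ leaves`.) -/
def pathCost (sel : Selector) : AOTree → ℕ
  | leaf => 1
  | orNode n c => if h : n = 0 then 0 else n * pathCost sel (c (sel n c h))
  | andNode n c => univ.sup fun i : Fin n => pathCost sel (c i)

/-- `sel` is a MIN-LEAF selector: it always keeps a child with the fewest leaves. -/
def IsMinLeaf (sel : Selector) : Prop :=
  ∀ (n : ℕ) (c : Fin n → AOTree) (h : n ≠ 0) (i : Fin n), leaves (c (sel n c h)) ≤ leaves (c i)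

end AOTree

/-! ### Pass-over paths and heights -/

/-- The individualisation steps of one root–leaf path of the recursion tree: step `i < t` takes the
vertex `x i` out of the cell `A i`.  Axioms: `mem`; `gone` — an individualised vertex lies in no later
cell (it is a singleton from then on); `nest` — a later cell that meets an earlier cell lies inside it
(cells only refine or restrict along a path). -/
structure PassOverPath (V : Type*) (t : ℕ) where
  /-- the cell individualised at step `i` -/
  A : Fin t → Finset V
  /-- the vertex individualised at step `i` -/
  x : Fin t → V
  /-- `x i ∈ A i` -/
  mem : ∀ i, x i ∈ A i
  /-- earlier individualised vertices are absent from later cells -/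
  gone : ∀ i j, i < j → x i ∉ A j
  /-- a later cell containing a point of an earlier cell lies inside it -/
  nest : ∀ i j, i < j → x j ∈ A i → A j ⊆ A i

namespace PassOverPath

variable {V : Type*} {t : ℕ} (P : PassOverPath V t)

/-- Step `i` PASSES OVER step `j`: `j` is later and its vertex was in the cell of step `i`. -/
def PassOver (i j : Fin t) : Prop := i < j ∧ P.x j ∈ P.A i

/-- `PassOver` is decidable. -/
instance [DecidableEq V] (i j : Fin t) : Decidable (P.PassOver i j) := by unfold PassOver; infer_instance

variable [DecidableEq V]

/-- The HEIGHT of step `i`: the length of the longest pass-over chain starting at `i`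
(`height i = max_{i passes over j} (height j + 1)`, `0` if `i` passes over nobody). -/
def height (i : Fin t) : ℕ :=
  (univ.filter fun j => P.PassOver i j).attach.sup fun j => height j.1 + 1
termination_by t - i.1
decreasing_by
  have hj := (mem_filter.1 j.2).2.1
  have : (j.1 : ℕ) < t := j.1.2
  simp only [Fin.lt_def] at hj
  omega

/-- Unfolding of `height`. -/
theorem height_eq (i : Fin t) :
    P.height i = (univ.filter fun j => P.PassOver i j).attach.sup fun j => P.height j.1 + 1 := by
  rw [height]

end PassOverPath

end CertifiedLabels

end Summit.PneNP.PneNP.Theorems
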